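import Mathlib
import HarnessLib
import Literature.Analysis.FluidPDE.VectorCalculus
import Summits.NavierStokesRegularity.NavierStokesRegularity.Theorems.UnthreadedRigidityDoorUnthreadedRigidityVirialHornAngularJets
import Summits.NavierStokesRegularity.NavierStokesRegularity.Theorems.UnthreadedRigidityDoorUnthreadedRigidityVirialHornAnalyticWedge

/-!
# W2 door `UnthreadedRigidity` (stmt-NavierStokesRegularity-27585) — SOLID HARMONICS: `∂_aY`, and ★ LEMMA Z «the zonal line»

Prover file (engine-1 g72; `--supports stmt-NavierStokesRegularity-27585 --as helper`; route-independent imports).  Tools for the W-lane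
(bracket injectivity) of LINE g11-1 «VIRIAL HORN» and for LINE g12-1 «CO-ZONAL».  §1 `hasFDerivAt_mvPolyEval` (`D(y ↦ P(y))v = Σᵢ(∂ᵢP)(y)vᵢ`,
induction on `P`) and `IsSolidHarmonic.fderiv_const`: `∂_aY = DY(·)a` of a solid harmonic of degree `l+1` is a solid harmonic of degree `l`
(polynomial `Σⱼ aⱼ∂ⱼP`, `IsHomogeneous.pderiv`; harmonic by `IsSolidHarmonic.trace_third`).  §2 zonality about `a` is inherited by `∂_aY`
(differentiate `⟪a, y × ∇Y⟫ ≡ 0` along `a`).  §3 THE PLANAR LIOUVILLE STEP: degree `m ≥ 1`, zonal about `a ≠ 0`, `∂_aY ≡ 0` ⇒ `Y ≡ 0` — off the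
axis `|u|²∇Y = ⟪u,∇Y⟫u` with `u = a × (a × y)`, and the trace of the derivative of `|u|²∇Y + m|a|²Y·u ≡ 0` is `−m²|a|⁴Y = 0` (planar twin of
g71's LEMMA R).  §4 ★ LEMMA Z `IsSolidHarmonic.eq_zero_of_isZonalAbout_of_apply_axis` (zonal + `Y(a) = 0` ⇒ `Y ≡ 0`, induction on the degree
through `∂_a`, Euler at `a`) and ★ `IsSolidHarmonic.zonal_line`: two zonal solid harmonics of one degree about one axis satisfy `Y₂(a)·Y₁ = Y₁(a)·Y₂`
(the `P_l(cos θ)` line, without Legendre theory).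
HONEST LABEL: elementary harmonic-polynomial facts serving RUNG lines about SPECIAL data; `UnthreadedRigidity` (27585), W2 and NS regularity remain
OPEN; nothing here is a statement about Navier–Stokes regularity.  0 kit.
-/

noncomputable section

-- the summit and its single sub-problem share the name (CONVENTIONS §1), as in every Theorems file
set_option linter.dupNamespace false

namespace Summit.NavierStokesRegularity.NavierStokesRegularity.Theorems.UnthreadedRigidity.VirialHorn

open scoped Topology InnerProductSpace
open Filter Set
open Literature.Analysis.FluidPDE (cross)
open Summit.NavierStokesRegularity.NavierStokesRegularity.Theorems.UnthreadedRigidity.ProfileHorn (E3)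
/-! ## §0 Coordinates (private copies, as in the other files of this door) -/

/-- components of the cross product. -/
private theorem cross_apply_zero (u v : E3) : cross u v 0 = u 1 * v 2 - u 2 * v 1 := by simp [cross, cross_apply]
/-- components of the cross product. -/
private theorem cross_apply_one (u v : E3) : cross u v 1 = u 2 * v 0 - u 0 * v 2 := by simp [cross, cross_apply]
/-- components of the cross product. -/
private theorem cross_apply_two (u v : E3) : cross u v 2 = u 0 * v 1 - u 1 * v 0 := by simp [cross, cross_apply]
/-- the inner product in coordinates. -/
private theorem real_inner_e3 (u v : E3) : ⟪u, v⟫_ℝ = u 0 * v 0 + u 1 * v 1 + u 2 * v 2 := by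
  simp [PiLp.inner_apply, Fin.sum_univ_three, mul_comm]
/-- `⟪v, eᵢ⟫ = vᵢ`. -/
private theorem inner_e_right (v : E3) (i : Fin 3) : ⟪v, e i⟫_ℝ = v i := by
  simp [e, EuclideanSpace.inner_single_right]
/-- `det[a,b,c] = ⟪a, b × c⟫`. -/
private theorem det3_eq_inner_cross' (a b c : E3) : det3 a b c = ⟪a, cross b c⟫_ℝ := by
  rw [real_inner_e3, cross_apply_zero, cross_apply_one, cross_apply_two, det3]; ring
/-- `DY(y)v = ⟪∇Y(y), v⟫`. -/
private theorem fderiv_apply_eq_inner_gradient (Y : E3 → ℝ) (y v : E3) : fderiv ℝ Y y v = ⟪gradient Y y, v⟫_ℝ := by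
  rw [gradient, InnerProductSpace.toDual_symm_apply]
/-! ## §1 Polynomial calculus: the derivative of an evaluation map; `∂_aY` is a solid harmonic -/
section Poly

open MvPolynomial

/-- THE DERIVATIVE OF A POLYNOMIAL MAP: `D(y ↦ P(y))(y) v = Σᵢ (∂ᵢP)(y) vᵢ`. -/
theorem hasFDerivAt_mvPolyEval (P : MvPolynomial (Fin 3) ℝ) (y : E3) :
    HasFDerivAt (fun y : E3 => eval (fun i => y i) P)
      (∑ i : Fin 3, (eval (fun j => y j) (pderiv i P)) • (EuclideanSpace.proj i : E3 →L[ℝ] ℝ)) y := by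
  induction P using MvPolynomial.induction_on with
  | C a => simpa [pderiv_C] using hasFDerivAt_const (a : ℝ) y
  | add p q hp hq =>
    have hfun : (fun y : E3 => eval (fun i => y i) (p + q)) = fun y : E3 => eval (fun i => y i) p + eval (fun i => y i) q := by
      funext z; simp only [map_add]
    rw [hfun]
    refine (hp.add hq).congr_fderiv ?_
    ext v
    simp only [map_add, _root_.add_apply, FunLike.coe_sum, Finset.sum_apply, _root_.smul_apply, smul_eq_mul,
      Finset.sum_add_distrib, add_mul]
  | mul_X p i hp =>
    have hc : HasFDerivAt (fun y : E3 => y i) (EuclideanSpace.proj i : E3 →L[ℝ] ℝ) y := (EuclideanSpace.proj i : E3 →L[ℝ] ℝ).hasFDerivAt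
    have h := hp.mul hc
    have hfun : (fun y : E3 => eval (fun j => y j) (p * X i)) = fun y : E3 => eval (fun j => y j) p * y i := by
      funext z; simp [map_mul, eval_X]
    rw [hfun]
    refine h.congr_fderiv ?_
    ext v
    simp only [pderiv_mul, pderiv_X, map_add, map_mul, eval_X, _root_.add_apply, _root_.smul_apply,
      FunLike.coe_sum, Finset.sum_apply, smul_eq_mul]
    simp only [Fin.sum_univ_three, Pi.single_apply]
    fin_cases i <;> simp <;> ring

/-- … hence `D(y ↦ P(y))(y) v = Σᵢ (∂ᵢP)(y) vᵢ` for `fderiv`. -/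
theorem fderiv_mvPolyEval_apply (P : MvPolynomial (Fin 3) ℝ) (y v : E3) :
    fderiv ℝ (fun y : E3 => eval (fun i => y i) P) y v = ∑ i : Fin 3, eval (fun j => y j) (pderiv i P) * v i := by
  rw [(hasFDerivAt_mvPolyEval P y).fderiv]
  simp

/-- `∂_aY = ⟪∇Y, a⟫` is smooth, with derivative `v ↦ ⟪D(∇Y)(y)v, a⟫`. -/
theorem IsSolidHarmonic.hasFDerivAt_fderiv_const {l : ℕ} {Y : E3 → ℝ} (hY : IsSolidHarmonic l Y) (a y : E3) :
    HasFDerivAt (fun z : E3 => fderiv ℝ Y z a) ((innerSL ℝ a).comp (fderiv ℝ (gradient Y) y)) y := by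
  have hg : HasFDerivAt (gradient Y) (fderiv ℝ (gradient Y) y) y :=
    ((hY.contDiff_gradient.differentiable (by simp)) y).hasFDerivAt
  have h := hg.inner ℝ (hasFDerivAt_const a y)
  have hfun : (fun z : E3 => fderiv ℝ Y z a) = fun z : E3 => ⟪gradient Y z, a⟫_ℝ := by
    funext z; exact fderiv_apply_eq_inner_gradient Y z a
  rw [hfun]
  refine h.congr_fderiv ?_
  ext v
  simp only [ContinuousLinearMap.comp_apply, ContinuousLinearMap.prod_apply, fderivInnerCLM_apply, innerSL_apply_apply,
    _root_.zero_apply, inner_zero_right, zero_add]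
  exact real_inner_comm _ _

/-- the gradient of `∂_aY` is `D(∇Y)(y) a` (symmetry of the Hessian). -/
theorem IsSolidHarmonic.gradient_fderiv_const {l : ℕ} {Y : E3 → ℝ} (hY : IsSolidHarmonic l Y) (a y : E3) :
    gradient (fun z : E3 => fderiv ℝ Y z a) y = fderiv ℝ (gradient Y) y a := by
  have h := (hY.hasFDerivAt_fderiv_const a y).fderiv
  rw [gradient, h]
  apply (InnerProductSpace.toDual ℝ E3).injective
  rw [LinearIsometryEquiv.apply_symm_apply]
  ext v
  simp only [ContinuousLinearMap.comp_apply, innerSL_apply_apply, InnerProductSpace.toDual_apply_apply]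
  rw [hY.hessian_symm]

/-- ★ THE DIRECTIONAL DERIVATIVE OF A SOLID HARMONIC IS A SOLID HARMONIC of one degree less. -/
theorem IsSolidHarmonic.fderiv_const {l : ℕ} {Y : E3 → ℝ} (hY : IsSolidHarmonic (l + 1) Y) (a : E3) :
    IsSolidHarmonic l (fun y : E3 => fderiv ℝ Y y a) := by
  obtain ⟨⟨P, hP, hYP⟩, -⟩ := id hY
  have hYf : Y = fun y : E3 => eval (fun i => y i) P := funext hYP
  refine ⟨⟨∑ j : Fin 3, C (a j) * pderiv j P, ?_, fun y => ?_⟩, fun y => ?_⟩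
  · refine IsHomogeneous.sum _ _ _ fun j _ => ?_
    have h := (hP.pderiv (i := j)).C_mul (a j)
    simpa using h
  · beta_reduce
    rw [hYf, fderiv_mvPolyEval_apply]
    simp only [map_sum, map_mul, eval_C]
    exact Finset.sum_congr rfl fun j _ => by ring
  · -- harmonicity: `Σᵢ ∂ᵢ∂ᵢ(∂_aY) = Σᵢ ⟪D²(∇Y)(y) a eᵢ, eᵢ⟫ = 0`
    unfold lap3 dir2
    have hder : ∀ v : E3, (fun z : E3 => fderiv ℝ (fun w : E3 => fderiv ℝ Y w a) z v) = fun z => ⟪fderiv ℝ (gradient Y) z v, a⟫_ℝ := by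
      intro v; funext z
      rw [(hY.hasFDerivAt_fderiv_const a z).fderiv]
      simp only [ContinuousLinearMap.comp_apply, innerSL_apply_apply]
      exact real_inner_comm _ _
    simp only [hder]
    have hstep : ∀ i : Fin 3, fderiv ℝ (fun z : E3 => ⟪fderiv ℝ (gradient Y) z (e i), a⟫_ℝ) y (e i)
        = ⟪fderiv ℝ (fderiv ℝ (gradient Y)) y a (e i), e i⟫_ℝ := by
      intro i
      have hH : HasFDerivAt (fderiv ℝ (gradient Y)) (fderiv ℝ (fderiv ℝ (gradient Y)) y) y :=
        ((hY.contDiff_hessian.differentiable (by simp)) y).hasFDerivAt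
      have h1 : HasFDerivAt (fun z : E3 => fderiv ℝ (gradient Y) z (e i)) ((fderiv ℝ (fderiv ℝ (gradient Y)) y).flip (e i)) y :=
        hH.clm_apply (hasFDerivAt_const (e i) y) |>.congr_fderiv (by ext v; simp)
      have h2 := h1.inner ℝ (hasFDerivAt_const a y)
      rw [h2.fderiv]
      simp only [ContinuousLinearMap.comp_apply, ContinuousLinearMap.prod_apply, fderivInnerCLM_apply,
        ContinuousLinearMap.flip_apply, _root_.zero_apply, inner_zero_right, zero_add]
      rw [hY.third_symm' y (e i) (e i) a, hY.third_symm y (e i) a]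
    simp only [hstep]
    exact hY.trace_third y a

end Poly
/-! ## §2 Zonality is inherited by `∂_aY` -/
section Zonal

variable {l : ℕ} {Y : E3 → ℝ} {a : E3}

/-- `⟪a, a × g⟫ = 0`. -/
private theorem inner_self_cross (a g : E3) : ⟪a, cross a g⟫_ℝ = 0 := by
  rw [real_inner_e3, cross_apply_zero, cross_apply_one, cross_apply_two]; ring

/-- ★ the directional derivative `∂_aY` of a solid harmonic zonal about `a` is zonal about `a`
(differentiate `⟪a, y × ∇Y⟫ ≡ 0` along `a`; `∇(∂_aY) = D(∇Y)a`). -/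
theorem IsSolidHarmonic.isZonalAbout_fderiv_const (hY : IsSolidHarmonic l Y) (hz : IsZonalAbout a Y) :
    IsZonalAbout a (fun y : E3 => fderiv ℝ Y y a) := by
  intro y
  rw [hY.gradient_fderiv_const a y, det3_eq_inner_cross']
  -- `Z(z) = ⟪a, z × ∇Y z⟫ ≡ 0`, so its derivative along `a` vanishes
  have hZ : (fun z : E3 => ⟪a, cross z (gradient Y z)⟫_ℝ) = fun _ => (0 : ℝ) := by
    funext z; rw [← det3_eq_inner_cross']; exact hz z
  have hd := (hasFDerivAt_const a y).inner ℝ (hY.hasFDerivAt_rot y)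
  have h0 : fderiv ℝ (fun z : E3 => ⟪a, cross z (gradient Y z)⟫_ℝ) y a = 0 := by
    rw [hZ, fderiv_const_apply]; rfl
  rw [hd.fderiv] at h0
  simp only [ContinuousLinearMap.comp_apply, ContinuousLinearMap.prod_apply, fderivInnerCLM_apply, _root_.zero_apply,
    inner_zero_left, _root_.add_apply, ContinuousLinearMap.precompR_apply, ContinuousLinearMap.compL_apply,
    ContinuousLinearMap.precompL_apply, Literature.Analysis.FluidPDE.crossCLM_apply, ContinuousLinearMap.id_apply, inner_add_right,
    inner_self_cross, add_zero] at h0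
  exact h0

end Zonal
/-! ## §3 The planar Liouville step: `∂_aY ≡ 0`, zonal about `a`, harmonic of degree `m ≥ 1` ⇒ `Y ≡ 0` -/
section Planar

variable {m : ℕ} {Y : E3 → ℝ} {a : E3}

/-- `(u × v) × w = ⟪u,w⟫ v − ⟪v,w⟫ u`. -/
private theorem cross_cross (u v w : E3) : cross (cross u v) w = ⟪u, w⟫_ℝ • v - ⟪v, w⟫_ℝ • u := by
  ext i
  fin_cases i <;> simp only [PiLp.sub_apply, PiLp.smul_apply, smul_eq_mul, real_inner_e3] <;>
    simp [cross_apply_zero, cross_apply_one, cross_apply_two] <;> ring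

/-- `X × Z = 0 ⇒ |Z|² X = ⟪Z,X⟫ Z` (BAC–CAB). -/
private theorem smul_eq_of_cross_eq_zero {X Z : E3} (h : cross X Z = 0) : ⟪Z, Z⟫_ℝ • X = ⟪Z, X⟫_ℝ • Z := by
  have hc : ∀ i : Fin 3, cross X Z i = 0 := fun i => by rw [h]; rfl
  have h0 := hc 0; have h1 := hc 1; have h2 := hc 2
  rw [cross_apply_zero] at h0; rw [cross_apply_one] at h1; rw [cross_apply_two] at h2
  ext i
  fin_cases i <;> simp only [PiLp.smul_apply, smul_eq_mul, real_inner_e3] <;> simp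
  · linear_combination (Z 1) * h2 - (Z 2) * h1
  · linear_combination (-(Z 0)) * h2 + (Z 2) * h0
  · linear_combination (Z 0) * h1 - (Z 1) * h0

/-- `a × (a × y) = ⟪a,y⟫ a − ⟪a,a⟫ y` in coordinates. -/
private theorem cross_cross_self_apply (a y : E3) (i : Fin 3) :
    cross a (cross a y) i = (a 0 * y 0 + a 1 * y 1 + a 2 * y 2) * a i - (a 0 * a 0 + a 1 * a 1 + a 2 * a 2) * y i := by
  fin_cases i <;> simp [cross_apply_zero, cross_apply_one, cross_apply_two] <;> ring

/-- THE PLANAR TRANSFER: if `⟪∇Y, a⟫ = 0` and `⟪a, y × ∇Y⟫ = 0`, then with `u = a × (a × y)`: `|u|² ∇Y = ⟪u, ∇Y⟫ u`. -/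
private theorem planar_transfer {g y : E3} (hga : ⟪g, a⟫_ℝ = 0) (hz : ⟪a, cross y g⟫_ℝ = 0) :
    ⟪cross a (cross a y), cross a (cross a y)⟫_ℝ • g = ⟪cross a (cross a y), g⟫_ℝ • cross a (cross a y) := by
  have hua : ⟪cross a (cross a y), a⟫_ℝ = 0 := by
    simp only [real_inner_e3, cross_cross_self_apply]; ring
  -- `(u × g) × a = ⟪u,a⟫g − ⟪g,a⟫u = 0` and `⟪a, u × g⟫ = 0`, so `u × g = 0`
  have h1 : cross (cross (cross a (cross a y)) g) a = 0 := by rw [cross_cross, hua, hga, zero_smul, zero_smul, sub_self]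
  have h2 := smul_eq_of_cross_eq_zero h1
  have h3 : ⟪a, cross (cross a (cross a y)) g⟫_ℝ = 0 := by
    have e : ⟪a, cross (cross a (cross a y)) g⟫_ℝ = (a 0 * y 0 + a 1 * y 1 + a 2 * y 2) * ⟪a, cross a g⟫_ℝ
        - (a 0 * a 0 + a 1 * a 1 + a 2 * a 2) * ⟪a, cross y g⟫_ℝ := by
      simp only [real_inner_e3, cross_apply_zero, cross_apply_one, cross_apply_two, cross_cross_self_apply]; ring
    rw [e, inner_self_cross, hz, mul_zero, mul_zero, sub_self]
  rw [h3, zero_smul] at h2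
  have hug : cross (cross a (cross a y)) g = 0 := by
    by_cases ha : a = 0
    · ext i
      fin_cases i <;> simp [ha, cross_apply_zero, cross_apply_one, cross_apply_two]
    · exact (smul_eq_zero.mp h2).resolve_left (real_inner_self_pos.2 ha).ne'
  have hgu : cross g (cross a (cross a y)) = 0 := by
    have : cross g (cross a (cross a y)) = -cross (cross a (cross a y)) g := by
      ext i
      fin_cases i <;> simp only [PiLp.neg_apply] <;> simp [cross_apply_zero, cross_apply_one, cross_apply_two] <;> ring
    rw [this, hug, neg_zero]
  exact smul_eq_of_cross_eq_zero hgu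

/-- ★ THE PLANAR LIOUVILLE STEP: a solid harmonic of degree `m ≥ 1`, zonal about `a ≠ 0`, with `∂_aY ≡ 0`, vanishes identically.
With `u(y) = a × (a × y)` (`= ⟪a,y⟫a − |a|²y`, linear): `|u|²∇Y = ⟪u,∇Y⟫u = −m|a|²Y·u` everywhere; the trace of the derivative of
`|u|²∇Y + m|a|²Y·u ≡ 0` is `−m²|a|⁴Y = 0`. -/
theorem IsSolidHarmonic.eq_zero_of_zonal_of_fderiv_axis (hY : IsSolidHarmonic m Y) (hm : 1 ≤ m) (ha : a ≠ 0)
    (hz : IsZonalAbout a Y) (hda : ∀ y : E3, fderiv ℝ Y y a = 0) : ∀ y, Y y = 0 := by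
  -- the linear map `U y = a × (a × y)`
  obtain ⟨U, hU⟩ : ∃ U : E3 →L[ℝ] E3, U = (Literature.Analysis.FluidPDE.crossCLM a).comp (Literature.Analysis.FluidPDE.crossCLM a) :=
    ⟨_, rfl⟩
  have hUap : ∀ v : E3, U v = cross a (cross a v) := fun v => by
    rw [hU]; simp [Literature.Analysis.FluidPDE.crossCLM_apply]
  have hUco : ∀ (v : E3) (i : Fin 3),
      (U v) i = (a 0 * v 0 + a 1 * v 1 + a 2 * v 2) * a i - (a 0 * a 0 + a 1 * a 1 + a 2 * a 2) * v i := fun v i => by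
    rw [hUap]; exact cross_cross_self_apply a v i
  have hga : ∀ y : E3, ⟪gradient Y y, a⟫_ℝ = 0 := fun y => by rw [← fderiv_apply_eq_inner_gradient]; exact hda y
  have hEul : ∀ y : E3, ⟪y, gradient Y y⟫_ℝ = (m : ℝ) * Y y := hY.inner_self_gradient
  have hUg : ∀ y : E3, ⟪U y, gradient Y y⟫_ℝ = -((a 0 * a 0 + a 1 * a 1 + a 2 * a 2) * ((m : ℝ) * Y y)) := by
    intro y
    have e : ⟪U y, gradient Y y⟫_ℝ = (a 0 * y 0 + a 1 * y 1 + a 2 * y 2) * ⟪gradient Y y, a⟫_ℝ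
        - (a 0 * a 0 + a 1 * a 1 + a 2 * a 2) * ⟪y, gradient Y y⟫_ℝ := by
      simp only [real_inner_e3, hUco]; ring
    rw [e, hga y, hEul y]; ring
  -- the field `F = |Uy|² ∇Y + m|a|² Y · Uy` vanishes identically
  obtain ⟨F, hF⟩ : ∃ F : E3 → E3, F = fun y => ⟪U y, U y⟫_ℝ • gradient Y y
      + (((m : ℝ) * (a 0 * a 0 + a 1 * a 1 + a 2 * a 2)) * Y y) • U y := ⟨_, rfl⟩
  have hF0 : F = fun _ => 0 := by
    rw [hF]
    funext y
    have hzy : ⟪a, cross y (gradient Y y)⟫_ℝ = 0 := by rw [← det3_eq_inner_cross']; exact hz y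
    have key := planar_transfer (hga y) hzy
    rw [← hUap] at key
    rw [key, hUg y, ← add_smul]
    have : -((a 0 * a 0 + a 1 * a 1 + a 2 * a 2) * ((m : ℝ) * Y y))
        + (m : ℝ) * (a 0 * a 0 + a 1 * a 1 + a 2 * a 2) * Y y = 0 := by ring
    rw [this, zero_smul]
  -- differentiate `F` and take the trace
  intro y
  have hfd : fderiv ℝ F y = 0 := by rw [hF0]; simp
  have hg : HasFDerivAt (gradient Y) (fderiv ℝ (gradient Y) y) y :=
    ((hY.contDiff_gradient.differentiable (by simp)) y).hasFDerivAt
  have hYd : HasFDerivAt Y (fderiv ℝ Y y) y := ((hY.contDiff.differentiable (by simp)) y).hasFDerivAt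
  have hn : HasFDerivAt (fun z : E3 => ⟪U z, U z⟫_ℝ) ((2 : ℝ) • (innerSL ℝ (U y)).comp U) y := by
    have h := (U.hasFDerivAt (x := y)).inner ℝ (U.hasFDerivAt (x := y))
    refine h.congr_fderiv ?_
    ext v
    simp only [ContinuousLinearMap.comp_apply, ContinuousLinearMap.prod_apply, fderivInnerCLM_apply, _root_.smul_apply,
      innerSL_apply_apply, smul_eq_mul]
    rw [real_inner_comm (U v) (U y)]; ring
  set c : ℝ := (m : ℝ) * (a 0 * a 0 + a 1 * a 1 + a 2 * a 2) with hc
  have hF' : HasFDerivAt F ((⟪U y, U y⟫_ℝ • fderiv ℝ (gradient Y) y + ((2 : ℝ) • (innerSL ℝ (U y)).comp U).smulRight (gradient Y y))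
      + ((c * Y y) • U + ((c • fderiv ℝ Y y)).smulRight (U y))) y := by
    have h1 := hn.smul hg
    have h2 := (hYd.const_mul c).smul (U.hasFDerivAt (x := y))
    rw [hF]
    exact h1.add h2
  have hzero : ∀ v : E3, ((⟪U y, U y⟫_ℝ • fderiv ℝ (gradient Y) y + ((2 : ℝ) • (innerSL ℝ (U y)).comp U).smulRight (gradient Y y))
      + ((c * Y y) • U + ((c • fderiv ℝ Y y)).smulRight (U y))) v = 0 := by
    intro v
    have := congrArg (fun L : E3 →L[ℝ] E3 => L v) (hF'.fderiv.symm.trans hfd)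
    simpa only [_root_.zero_apply] using this
  -- in coordinates
  have hfY : ∀ v, fderiv ℝ Y y v = ⟪gradient Y y, v⟫_ℝ := fun v => fderiv_apply_eq_inner_gradient Y y v
  have he : ∀ (w : E3) (i : Fin 3), ⟪w, e i⟫_ℝ = w i := fun w i => inner_e_right w i
  have key : ∀ i : Fin 3, ⟪U y, U y⟫_ℝ * (fderiv ℝ (gradient Y) y (e i)) i + 2 * ⟪U y, U (e i)⟫_ℝ * (gradient Y y) i
      + (c * Y y * (U (e i)) i + c * (gradient Y y) i * (U y) i) = 0 := by
    intro i
    have := congrArg (fun w : E3 => w i) (hzero (e i))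
    simp only [_root_.add_apply, _root_.smul_apply, ContinuousLinearMap.smulRight_apply, ContinuousLinearMap.comp_apply,
      innerSL_apply_apply, PiLp.add_apply, PiLp.smul_apply, smul_eq_mul, PiLp.zero_apply, hfY, he] at this
    linear_combination this
  have htr' : (fderiv ℝ (gradient Y) y (e 0)) 0 + (fderiv ℝ (gradient Y) y (e 1)) 1 + (fderiv ℝ (gradient Y) y (e 2)) 2 = 0 := by
    have := hY.trace_hessian y
    simpa only [Fin.sum_univ_three, he] using this
  have hga' : (gradient Y y) 0 * a 0 + (gradient Y y) 1 * a 1 + (gradient Y y) 2 * a 2 = 0 := by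
    have := hga y; rwa [real_inner_e3] at this
  have hEul' : y 0 * (gradient Y y) 0 + y 1 * (gradient Y y) 1 + y 2 * (gradient Y y) 2 = (m : ℝ) * Y y := by
    have := hEul y; rwa [real_inner_e3] at this
  have k0 := key 0; have k1 := key 1; have k2 := key 2
  have he0 : (e 0 : E3) 0 = 1 ∧ (e 0 : E3) 1 = 0 ∧ (e 0 : E3) 2 = 0 := by simp [e]
  have he1 : (e 1 : E3) 0 = 0 ∧ (e 1 : E3) 1 = 1 ∧ (e 1 : E3) 2 = 0 := by simp [e]
  have he2 : (e 2 : E3) 0 = 0 ∧ (e 2 : E3) 1 = 0 ∧ (e 2 : E3) 2 = 1 := by simp [e]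
  simp only [real_inner_e3, hUco, he0.1, he0.2.1, he0.2.2, he1.1, he1.2.1, he1.2.2, he2.1, he2.2.1, he2.2.2] at k0 k1 k2
  -- `m²|a|⁴ Y = 0`
  set A : ℝ := a 0 * a 0 + a 1 * a 1 + a 2 * a 2 with hA
  set ay : ℝ := a 0 * y 0 + a 1 * y 1 + a 2 * y 2 with hay
  have hmain : c * c * Y y = 0 := by
    rw [hc]
    linear_combination (-1 : ℝ) * (k0 + k1 + k2)
      + ((ay * a 0 - A * y 0) * (ay * a 0 - A * y 0) + (ay * a 1 - A * y 1) * (ay * a 1 - A * y 1)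
          + (ay * a 2 - A * y 2) * (ay * a 2 - A * y 2)) * htr'
      + ((-2 * A + (m : ℝ) * A) * ay) * hga' + (2 * A * A - (m : ℝ) * A * A) * hEul'
  have hApos : 0 < A := by have := real_inner_self_pos.2 ha; rwa [real_inner_e3] at this
  have hcne : c ≠ 0 := by rw [hc]; exact mul_ne_zero (by exact_mod_cast (by omega : m ≠ 0)) hApos.ne'
  exact (mul_eq_zero.mp hmain).resolve_left (mul_ne_zero hcne hcne)

end Planar
/-! ## §4 ★ LEMMA Z: the zonal solid harmonics of one degree about one axis form a line -/
section Line

/-- ★ **LEMMA Z**: a solid harmonic of degree `l`, zonal about `a ≠ 0` and vanishing at the axis point `a`, vanishes identically.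
Induction on `l` through `∂_a`: `∂_aY` is a zonal solid harmonic of degree `l − 1` with `(∂_aY)(a) = l·Y(a)/… = 0` (Euler), so
`∂_aY ≡ 0` by induction, and then `Y ≡ 0` by the planar Liouville step; degree `0`: a constant. -/
theorem IsSolidHarmonic.eq_zero_of_isZonalAbout_of_apply_axis :
    ∀ (l : ℕ) (Y : E3 → ℝ), IsSolidHarmonic l Y → ∀ {a : E3}, a ≠ 0 → IsZonalAbout a Y → Y a = 0 → ∀ y, Y y = 0 := by
  intro l
  induction l with
  | zero =>
    intro Y hY a _ _ h0 y
    have h1 := hY.apply_smul 0 y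
    have h2 := hY.apply_smul 0 a
    simp only [zero_smul, pow_zero, one_mul] at h1 h2
    rw [← h1, h2, h0]
  | succ l ih =>
    intro Y hY a ha hz h0
    have hY' : IsSolidHarmonic l (fun y : E3 => fderiv ℝ Y y a) := hY.fderiv_const a
    have hz' : IsZonalAbout a (fun y : E3 => fderiv ℝ Y y a) := hY.isZonalAbout_fderiv_const hz
    have h0' : (fun y : E3 => fderiv ℝ Y y a) a = 0 := by
      show fderiv ℝ Y a a = 0
      rw [fderiv_apply_eq_inner_gradient, real_inner_comm, hY.inner_self_gradient, h0, mul_zero]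
    have hda : ∀ y : E3, fderiv ℝ Y y a = 0 := ih _ hY' ha hz' h0'
    exact hY.eq_zero_of_zonal_of_fderiv_axis (by omega) ha hz hda

/-- `det[a, y, ∇F(y)] = DF(y)(a × y)`. -/
private theorem det3_gradient_eq_fderiv (F : E3 → ℝ) (a y : E3) : det3 a y (gradient F y) = fderiv ℝ F y (cross a y) := by
  rw [fderiv_apply_eq_inner_gradient, real_inner_comm]
  rw [real_inner_e3, cross_apply_zero, cross_apply_one, cross_apply_two, det3]; ring

/-- ★ **THE ZONAL LINE**: two solid harmonics of the SAME degree, zonal about the SAME axis `a ≠ 0`, are proportional: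
`Y₂(a)·Y₁ = Y₁(a)·Y₂` (the combination `Y₂(a)Y₁ − Y₁(a)Y₂` is a zonal solid harmonic vanishing at `a`). -/
theorem IsSolidHarmonic.zonal_line {l : ℕ} {Y₁ Y₂ : E3 → ℝ} (hY₁ : IsSolidHarmonic l Y₁) (hY₂ : IsSolidHarmonic l Y₂) {a : E3}
    (ha : a ≠ 0) (hz₁ : IsZonalAbout a Y₁) (hz₂ : IsZonalAbout a Y₂) : ∀ y, Y₂ a * Y₁ y = Y₁ a * Y₂ y := by
  -- the combination as a `Fin 2`-sum
  set v : Fin 2 → ℝ := ![Y₂ a, -Y₁ a] with hv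
  set B : Fin 2 → E3 → ℝ := ![Y₁, Y₂] with hB
  have hBh : ∀ k, IsSolidHarmonic l (B k) := fun k => by
    fin_cases k
    · simpa [hB] using hY₁
    · simpa [hB] using hY₂
  have hW : IsSolidHarmonic l (fun y => ∑ k, v k * B k y) := isSolidHarmonic_comb v B hBh
  have hWe : ∀ y, (∑ k, v k * B k y) = Y₂ a * Y₁ y - Y₁ a * Y₂ y := fun y => by
    simp [hv, hB, Fin.sum_univ_two]; ring
  have hWz : IsZonalAbout a (fun y => ∑ k, v k * B k y) := by
    intro y
    have hd : ∀ k, Differentiable ℝ (B k) := fun k => (hBh k).contDiff.differentiable (by simp)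
    rw [det3_gradient_eq_fderiv, fderiv_comb_apply v B hd]
    have h1 := hz₁ y; have h2 := hz₂ y
    rw [det3_gradient_eq_fderiv] at h1 h2
    simp [hv, hB, Fin.sum_univ_two, h1, h2]
  have hWa : (fun y => ∑ k, v k * B k y) a = 0 := by
    show (∑ k, v k * B k a) = 0
    rw [hWe]; ring
  intro y
  have := IsSolidHarmonic.eq_zero_of_isZonalAbout_of_apply_axis l _ hW ha hWz hWa y
  rw [hWe] at this
  linarith

end Line

end Summit.NavierStokesRegularity.NavierStokesRegularity.Theorems.UnthreadedRigidity.VirialHorn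

end
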